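import Summits.MatrixMultiplication.MatrixMultiplication.Theorems.SoloInformedValLabelled

/-!
# SoloInformedValInducedMatching — the induced-matching packing bound for normal-form triples

Sequel of `SoloInformedValLabelled` / `SoloInformedValCompleteBlock` (K. Pratt, *On generalized corners and
matrix multiplication*, arXiv:2309.03878, Def. 3.2: equilateral trapezoid-free triples and `Val`).

NORMAL-FORM TRIPLES.  Let `G` be an additive commutative group, `x : I → G`, `y : J → G`, `z : K → G`
("potentials") and `H_IJ ⊆ I × J`, `H_JK ⊆ J × K`, `H_KI ⊆ K × I` three finite bipartite graphs.  The
normal-form triple is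
`A = {x i - y j : (i,j) ∈ H_IJ}`, `B = {y j - z k : (j,k) ∈ H_JK}`, `C = {z k - x i : (k,i) ∈ H_KI}` (target `0`);
every STPP image and every superlinear `Val` configuration known to this seat has this shape.  The condition
NO ACCIDENTAL SOLUTIONS (`NoAccidental`) says that
`(x i - y j) + (y j' - z k) + (z k' - x i') = 0` with `(i,j) ∈ H_IJ`, `(j',k) ∈ H_JK`, `(k',i') ∈ H_KI` forces
`i = i'`, `j = j'`, `k = k'`; then the solutions of `a + b + c = 0` are exactly the images of the TRIANGLES
`(i,j,k)` (`(i,j) ∈ H_IJ`, `(j,k) ∈ H_JK`, `(k,i) ∈ H_KI`) of the tripartite graph, and (with injective difference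
maps) the triple is `Labelled`, hence equilateral trapezoid-free (`labelled_normalForm`,
`trapezoidFreeG_normalForm`).

THE BOUND.  An INDUCED MATCHING of `H_JK` is a set `M ⊆ H_JK` of edges such that for two distinct edges
`(j,k) ≠ (j',k')` of `M` the cross pair `(j,k')` is NOT an edge of `H_JK` (`IsInducedMatching`; this forces
`j ≠ j'`, `k ≠ k'` and both cross pairs absent).  Main results, for `G` finite:

* `NoAccidental.card_triangles_le_mul`: if every induced matching of `H_JK` has at most `ν` edges, then every
  finite set of triangles has at most `|G| · ν` elements;
* `NoAccidental.card_solutionsG_le_mul`: hence `#solutionsG A B C 0 ≤ |G| · ν` for the normal-form triple;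
* `NoAccidental.card_solutionsG_le_card_of_crossClosed`: if `H_JK` is cross-closed
  (`(j,k), (j',k') ∈ H_JK ⟹ (j,k') ∈ H_JK`, i.e. complete bipartite on its vertex sets) then `ν = 1` and the
  configuration is LINEAR, `#solutionsG ≤ |G|` — this contains "one complete block is linear"
  (`SoloInformedValCompleteBlock`) and shows that superlinearity needs large induced matchings in ALL THREE
  graphs (apply the theorem to the cyclic shifts).

PROOF.  The potential map `φ(i,j,k) = x i - y j - z k` has controlled collisions: if two distinct triangles
`τ = (i,j,k)`, `τ' = (i',j',k')` have `φ τ = φ τ'`, then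
`(x i - y j) + (y j' - z k) + (z k' - x i') = φ τ - φ τ' = 0`, so `(j',k) ∈ H_JK` would be an accidental
solution forcing `τ = τ'`; hence `(j',k) ∉ H_JK`, and symmetrically `(j,k') ∉ H_JK`
(`NoAccidental.cross_not_mem`).  So each fibre of `φ` on a set of triangles projects injectively onto an
induced matching of `H_JK` (`NoAccidental.card_fibre_le`), and there are at most `|G|` fibres.

solo-informed MatrixMultiplication, gen 75 (dossier `paper/val-superlinear.md` §15.6).  Elementary; no `sorry`.
-/

namespace Summit.MatrixMultiplication.MatrixMultiplication.Theorems.SoloVal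

open Finset

section NormalForm

variable {G : Type*} [AddCommGroup G]
variable {I J K : Type*}

/-- NO ACCIDENTAL SOLUTIONS for the potentials `x, y, z` on the graphs `H_IJ, H_JK, H_KI`: a vanishing sum
`(x i - y j) + (y j' - z k) + (z k' - x i') = 0` of an `A`-, a `B`- and a `C`-difference has matching indices. -/
def NoAccidental (x : I → G) (y : J → G) (z : K → G)
    (HIJ : Finset (I × J)) (HJK : Finset (J × K)) (HKI : Finset (K × I)) : Prop :=
  ∀ i j j' k k' i', (i, j) ∈ HIJ → (j', k) ∈ HJK → (k', i') ∈ HKI →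
    (x i - y j) + (y j' - z k) + (z k' - x i') = 0 → i = i' ∧ j = j' ∧ k = k'

/-- `τ = (i, j, k)` is a triangle of the tripartite graph `(H_IJ, H_JK, H_KI)`. -/
def IsTriangle (HIJ : Finset (I × J)) (HJK : Finset (J × K)) (HKI : Finset (K × I)) (τ : I × J × K) : Prop :=
  (τ.1, τ.2.1) ∈ HIJ ∧ (τ.2.1, τ.2.2) ∈ HJK ∧ (τ.2.2, τ.1) ∈ HKI

/-- An INDUCED MATCHING of the bipartite graph `H ⊆ J × K`: a set of edges no two distinct members of which
are joined by a cross edge `(e.1, e'.2) ∈ H` (applied in both orders this says: distinct `J`-ends, distinct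
`K`-ends, and neither cross pair is an edge). -/
def IsInducedMatching (H M : Finset (J × K)) : Prop :=
  M ⊆ H ∧ ∀ e ∈ M, ∀ e' ∈ M, e ≠ e' → (e.1, e'.2) ∉ H

/-- The potential map `φ(i,j,k) = x i - y j - z k`. -/
def phi (x : I → G) (y : J → G) (z : K → G) (τ : I × J × K) : G :=
  x τ.1 - y τ.2.1 - z τ.2.2

variable {x : I → G} {y : J → G} {z : K → G}
variable {HIJ : Finset (I × J)} {HJK : Finset (J × K)} {HKI : Finset (K × I)}

/-- In a cross-closed graph every induced matching has at most one edge. -/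
theorem card_le_one_of_crossClosed {H M : Finset (J × K)}
    (hH : ∀ e ∈ H, ∀ e' ∈ H, (e.1, e'.2) ∈ H) (hM : IsInducedMatching H M) : M.card ≤ 1 := by
  rw [Finset.card_le_one]
  intro e he e' he'
  by_contra hne
  exact hM.2 e he e' he' hne (hH e (hM.1 he) e' (hM.1 he'))

/-- COLLISION LEMMA.  Two distinct triangles with the same potential have their cross pair `(j', k)` outside
`H_JK`. -/
theorem NoAccidental.cross_not_mem (hN : NoAccidental x y z HIJ HJK HKI)
    {τ τ' : I × J × K} (hτ : IsTriangle HIJ HJK HKI τ) (hτ' : IsTriangle HIJ HJK HKI τ')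
    (hne : τ ≠ τ') (hφ : phi x y z τ = phi x y z τ') : (τ'.2.1, τ.2.2) ∉ HJK := by
  intro hmem
  obtain ⟨i, j, k⟩ := τ
  obtain ⟨i', j', k'⟩ := τ'
  obtain ⟨h1, -, h3⟩ := hτ
  obtain ⟨-, -, h3'⟩ := hτ'
  simp only [phi] at hφ hmem h1 h3 h3'
  have hsum : (x i - y j) + (y j' - z k) + (z k' - x i') = 0 := by
    have h0 : x i - y j - z k - (x i' - y j' - z k') = 0 := sub_eq_zero.mpr hφ
    calc (x i - y j) + (y j' - z k) + (z k' - x i')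
        = x i - y j - z k - (x i' - y j' - z k') := by abel
      _ = 0 := h0
  obtain ⟨rfl, rfl, rfl⟩ := hN i j j' k k' i' h1 hmem h3' hsum
  exact hne rfl

/-- Two distinct triangles with the same potential have distinct `J`-coordinates. -/
theorem NoAccidental.snd_ne (hN : NoAccidental x y z HIJ HJK HKI)
    {τ τ' : I × J × K} (hτ : IsTriangle HIJ HJK HKI τ) (hτ' : IsTriangle HIJ HJK HKI τ')
    (hne : τ ≠ τ') (hφ : phi x y z τ = phi x y z τ') : τ.2.1 ≠ τ'.2.1 := by
  intro heq
  have h := hN.cross_not_mem hτ hτ' hne hφ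
  rw [← heq] at h
  exact h hτ.2.1

/-- FIBRE LEMMA.  On a finite set of triangles, each fibre of the potential map projects injectively onto an
induced matching of `H_JK`; so its size is at most any bound `ν` for induced matchings of `H_JK`. -/
theorem NoAccidental.card_fibre_le [DecidableEq G] [DecidableEq J] [DecidableEq K]
    (hN : NoAccidental x y z HIJ HJK HKI) {S : Finset (I × J × K)}
    (hS : ∀ τ ∈ S, IsTriangle HIJ HJK HKI τ) {ν : ℕ}
    (hν : ∀ M : Finset (J × K), IsInducedMatching HJK M → M.card ≤ ν) (g : G) :
    (S.filter (fun τ => phi x y z τ = g)).card ≤ ν := by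
  set F := S.filter (fun τ => phi x y z τ = g) with hF
  have hmemF : ∀ τ ∈ F, IsTriangle HIJ HJK HKI τ ∧ phi x y z τ = g := by
    intro τ hτ
    rw [hF, Finset.mem_filter] at hτ
    exact ⟨hS τ hτ.1, hτ.2⟩
  -- the projection to the `(j, k)` pair
  let pr : I × J × K → J × K := fun τ => (τ.2.1, τ.2.2)
  have hinj : Set.InjOn pr ↑F := by
    intro τ hτ τ' hτ' heq
    by_contra hne
    have h1 := hmemF τ (Finset.mem_coe.mp hτ)
    have h2 := hmemF τ' (Finset.mem_coe.mp hτ')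
    have hj : τ.2.1 = τ'.2.1 := congrArg Prod.fst heq
    exact hN.snd_ne h1.1 h2.1 hne (h1.2.trans h2.2.symm) hj
  have hM : IsInducedMatching HJK (F.image pr) := by
    refine ⟨?_, ?_⟩
    · intro e he
      obtain ⟨τ, hτ, rfl⟩ := Finset.mem_image.mp he
      exact (hmemF τ hτ).1.2.1
    · intro e he e' he' hne
      obtain ⟨τ, hτ, rfl⟩ := Finset.mem_image.mp he
      obtain ⟨τ', hτ', rfl⟩ := Finset.mem_image.mp he'
      have hττ' : τ ≠ τ' := by
        rintro rfl
        exact hne rfl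
      have h1 := hmemF τ hτ
      have h2 := hmemF τ' hτ'
      -- cross pair `(τ.j, τ'.k)`: use the collision lemma with the roles of `τ, τ'` exchanged
      exact hN.cross_not_mem h2.1 h1.1 hττ'.symm (h2.2.trans h1.2.symm)
  calc F.card = (F.image pr).card := (Finset.card_image_of_injOn hinj).symm
    _ ≤ ν := hν _ hM

/-- THE INDUCED-MATCHING PACKING BOUND.  In a finite group, a set of triangles of a normal-form triple without
accidental solutions has at most `|G| · ν` elements, `ν` any bound for the induced matchings of `H_JK`. -/
theorem NoAccidental.card_triangles_le_mul [Fintype G] [DecidableEq G] [DecidableEq J] [DecidableEq K]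
    (hN : NoAccidental x y z HIJ HJK HKI) {S : Finset (I × J × K)}
    (hS : ∀ τ ∈ S, IsTriangle HIJ HJK HKI τ) {ν : ℕ}
    (hν : ∀ M : Finset (J × K), IsInducedMatching HJK M → M.card ≤ ν) :
    S.card ≤ Fintype.card G * ν := by
  have h1 : S.card ≤ ν * (S.image (phi x y z)).card :=
    Finset.card_le_mul_card_image S ν (fun g _ => hN.card_fibre_le hS hν g)
  have h2 : (S.image (phi x y z)).card ≤ Fintype.card G := Finset.card_le_univ _
  calc S.card ≤ ν * (S.image (phi x y z)).card := h1
    _ ≤ ν * Fintype.card G := Nat.mul_le_mul_left _ h2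
    _ = Fintype.card G * ν := Nat.mul_comm _ _

/-- Cross-closed `H_JK` (complete bipartite on its vertex sets): every set of triangles is LINEAR. -/
theorem NoAccidental.card_triangles_le_card_of_crossClosed [Fintype G] [DecidableEq G] [DecidableEq J]
    [DecidableEq K] (hN : NoAccidental x y z HIJ HJK HKI) {S : Finset (I × J × K)}
    (hS : ∀ τ ∈ S, IsTriangle HIJ HJK HKI τ) (hH : ∀ e ∈ HJK, ∀ e' ∈ HJK, (e.1, e'.2) ∈ HJK) :
    S.card ≤ Fintype.card G := by
  have h := hN.card_triangles_le_mul hS (ν := 1) (fun M hM => card_le_one_of_crossClosed hH hM)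
  simpa using h

/-! ### The normal-form triple and its solutions -/

/-- The finite set of all triangles of `(H_IJ, H_JK, H_KI)`. -/
def triangleSet [DecidableEq I] [DecidableEq J] [DecidableEq K]
    (HIJ : Finset (I × J)) (HJK : Finset (J × K)) (HKI : Finset (K × I)) : Finset (I × J × K) :=
  ((HIJ ×ˢ HJK).filter (fun p => p.1.2 = p.2.1 ∧ (p.2.2, p.1.1) ∈ HKI)).image
    (fun p => (p.1.1, p.1.2, p.2.2))

/-- Membership in `triangleSet` is the triangle predicate. -/
theorem mem_triangleSet [DecidableEq I] [DecidableEq J] [DecidableEq K] {τ : I × J × K} :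
    τ ∈ triangleSet HIJ HJK HKI ↔ IsTriangle HIJ HJK HKI τ := by
  constructor
  · intro h
    obtain ⟨p, hp, rfl⟩ := Finset.mem_image.mp h
    rw [Finset.mem_filter, Finset.mem_product] at hp
    obtain ⟨⟨hp1, hp2⟩, hj, hk⟩ := hp
    refine ⟨hp1, ?_, hk⟩
    simp only
    rw [hj]
    exact hp2
  · intro h
    obtain ⟨i, j, k⟩ := τ
    obtain ⟨h1, h2, h3⟩ := h
    refine Finset.mem_image.mpr ⟨((i, j), (j, k)), ?_, rfl⟩
    rw [Finset.mem_filter, Finset.mem_product]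
    exact ⟨⟨h1, h2⟩, rfl, h3⟩

/-- The `A`-part of the normal-form triple: `{x i - y j : (i,j) ∈ H_IJ}`. -/
def nfA [DecidableEq G] (x : I → G) (y : J → G) (HIJ : Finset (I × J)) : Finset G :=
  HIJ.image (fun p => x p.1 - y p.2)

/-- The `B`-part `{y j - z k : (j,k) ∈ H_JK}`. -/
def nfB [DecidableEq G] (y : J → G) (z : K → G) (HJK : Finset (J × K)) : Finset G :=
  HJK.image (fun q => y q.1 - z q.2)

/-- The `C`-part `{z k - x i : (k,i) ∈ H_KI}`. -/
def nfC [DecidableEq G] (z : K → G) (x : I → G) (HKI : Finset (K × I)) : Finset G :=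
  HKI.image (fun r => z r.1 - x r.2)

/-- Without accidental solutions, every solution of `a + b + c = 0` in the normal-form triple is the image of a
triangle under `(i,j,k) ↦ (x i - y j, y j - z k, z k - x i)`. -/
theorem NoAccidental.solutionsG_subset_image [DecidableEq G] [DecidableEq I] [DecidableEq J] [DecidableEq K]
    (hN : NoAccidental x y z HIJ HJK HKI) :
    solutionsG (nfA x y HIJ) (nfB y z HJK) (nfC z x HKI) 0 ⊆
      (triangleSet HIJ HJK HKI).image (fun τ => (x τ.1 - y τ.2.1, y τ.2.1 - z τ.2.2, z τ.2.2 - x τ.1)) := by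
  rintro ⟨a, b, c⟩ hp
  unfold solutionsG at hp
  rw [Finset.mem_filter, Finset.mem_product, Finset.mem_product] at hp
  obtain ⟨⟨ha, hb, hc⟩, hsum⟩ := hp
  obtain ⟨⟨i, j⟩, hij, hpa⟩ := Finset.mem_image.mp ha
  obtain ⟨⟨j', k⟩, hjk, hpb⟩ := Finset.mem_image.mp hb
  obtain ⟨⟨k', i'⟩, hki, hpc⟩ := Finset.mem_image.mp hc
  simp only at hpa hpb hpc hsum
  have h0 : (x i - y j) + (y j' - z k) + (z k' - x i') = 0 := by
    rw [hpa, hpb, hpc]; exact hsum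
  obtain ⟨h1, h2, h3⟩ := hN i j j' k k' i' hij hjk hki h0
  rw [← h2] at hjk hpb
  rw [← h3, ← h1] at hki hpc
  refine Finset.mem_image.mpr ⟨(i, j, k), mem_triangleSet.mpr ⟨hij, hjk, hki⟩, ?_⟩
  simp only [hpa, hpb, hpc]

/-- THE BOUND FOR SOLUTIONS.  `#solutionsG A B C 0 ≤ |G| · ν` for the normal-form triple without accidental
solutions, `ν` any bound for the induced matchings of `H_JK`. -/
theorem NoAccidental.card_solutionsG_le_mul [Fintype G] [DecidableEq G] [DecidableEq I] [DecidableEq J]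
    [DecidableEq K] (hN : NoAccidental x y z HIJ HJK HKI) {ν : ℕ}
    (hν : ∀ M : Finset (J × K), IsInducedMatching HJK M → M.card ≤ ν) :
    (solutionsG (nfA x y HIJ) (nfB y z HJK) (nfC z x HKI) 0).card ≤ Fintype.card G * ν := by
  calc (solutionsG (nfA x y HIJ) (nfB y z HJK) (nfC z x HKI) 0).card
      ≤ ((triangleSet HIJ HJK HKI).image
          (fun τ => (x τ.1 - y τ.2.1, y τ.2.1 - z τ.2.2, z τ.2.2 - x τ.1))).card :=
        Finset.card_le_card hN.solutionsG_subset_image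
    _ ≤ (triangleSet HIJ HJK HKI).card := Finset.card_image_le
    _ ≤ Fintype.card G * ν :=
        hN.card_triangles_le_mul (fun τ hτ => mem_triangleSet.mp hτ) hν

/-- LINEARITY UNDER ONE CROSS-CLOSED GRAPH: if `H_JK` is complete bipartite on its vertex sets, the normal-form
triple has at most `|G|` solutions (contains "one complete block is linear"). -/
theorem NoAccidental.card_solutionsG_le_card_of_crossClosed [Fintype G] [DecidableEq G] [DecidableEq I]
    [DecidableEq J] [DecidableEq K] (hN : NoAccidental x y z HIJ HJK HKI)
    (hH : ∀ e ∈ HJK, ∀ e' ∈ HJK, (e.1, e'.2) ∈ HJK) :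
    (solutionsG (nfA x y HIJ) (nfB y z HJK) (nfC z x HKI) 0).card ≤ Fintype.card G := by
  have h := hN.card_solutionsG_le_mul (ν := 1) (fun M hM => card_le_one_of_crossClosed hH hM)
  simpa using h

/-! ### Normal-form triples without accidental solutions are labelled, hence trapezoid-free -/

/-- The `A`-labelling: a left inverse of `(i,j) ↦ x i - y j` on `H_IJ` (by choice). -/
noncomputable def nfLabelA [Nonempty I] [Nonempty J] (x : I → G) (y : J → G) (HIJ : Finset (I × J)) :
    G → I × J :=
  Function.invFunOn (fun p : I × J => x p.1 - y p.2) (↑HIJ : Set (I × J))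

/-- The `B`-labelling. -/
noncomputable def nfLabelB [Nonempty J] [Nonempty K] (y : J → G) (z : K → G) (HJK : Finset (J × K)) :
    G → J × K :=
  Function.invFunOn (fun q : J × K => y q.1 - z q.2) (↑HJK : Set (J × K))

/-- The `C`-labelling. -/
noncomputable def nfLabelC [Nonempty K] [Nonempty I] (z : K → G) (x : I → G) (HKI : Finset (K × I)) :
    G → K × I :=
  Function.invFunOn (fun r : K × I => z r.1 - x r.2) (↑HKI : Set (K × I))

/-- A normal-form triple with injective difference maps and no accidental solutions is `Labelled` by the
left-inverse labellings. -/
theorem labelled_normalForm [DecidableEq G] [Nonempty I] [Nonempty J] [Nonempty K]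
    (hLA : Set.InjOn (fun p : I × J => x p.1 - y p.2) ↑HIJ)
    (hLB : Set.InjOn (fun q : J × K => y q.1 - z q.2) ↑HJK)
    (hLC : Set.InjOn (fun r : K × I => z r.1 - x r.2) ↑HKI)
    (hN : NoAccidental x y z HIJ HJK HKI) :
    Labelled (nfA x y HIJ) (nfB y z HJK) (nfC z x HKI) 0
      (nfLabelA x y HIJ) (nfLabelB y z HJK) (nfLabelC z x HKI) := by
  have eA : ∀ p ∈ HIJ, nfLabelA x y HIJ (x p.1 - y p.2) = p :=
    fun p hp => hLA.leftInvOn_invFunOn (Finset.mem_coe.mpr hp)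
  have eB : ∀ q ∈ HJK, nfLabelB y z HJK (y q.1 - z q.2) = q :=
    fun q hq => hLB.leftInvOn_invFunOn (Finset.mem_coe.mpr hq)
  have eC : ∀ r ∈ HKI, nfLabelC z x HKI (z r.1 - x r.2) = r :=
    fun r hr => hLC.leftInvOn_invFunOn (Finset.mem_coe.mpr hr)
  refine ⟨?_, ?_, ?_, ?_⟩
  · intro a ha a' ha' h
    obtain ⟨p, hp, rfl⟩ := Finset.mem_image.mp (Finset.mem_coe.mp ha)
    obtain ⟨p', hp', rfl⟩ := Finset.mem_image.mp (Finset.mem_coe.mp ha')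
    rw [eA p hp, eA p' hp'] at h
    rw [h]
  · intro b hb b' hb' h
    obtain ⟨q, hq, rfl⟩ := Finset.mem_image.mp (Finset.mem_coe.mp hb)
    obtain ⟨q', hq', rfl⟩ := Finset.mem_image.mp (Finset.mem_coe.mp hb')
    rw [eB q hq, eB q' hq'] at h
    rw [h]
  · intro c hc c' hc' h
    obtain ⟨r, hr, rfl⟩ := Finset.mem_image.mp (Finset.mem_coe.mp hc)
    obtain ⟨r', hr', rfl⟩ := Finset.mem_image.mp (Finset.mem_coe.mp hc')
    rw [eC r hr, eC r' hr'] at h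
    rw [h]
  · intro a ha b hb c hc hsum
    obtain ⟨⟨i, j⟩, hij, rfl⟩ := Finset.mem_image.mp ha
    obtain ⟨⟨j', k⟩, hjk, rfl⟩ := Finset.mem_image.mp hb
    obtain ⟨⟨k', i'⟩, hki, rfl⟩ := Finset.mem_image.mp hc
    obtain ⟨rfl, rfl, rfl⟩ := hN i j j' k k' i' hij hjk hki hsum
    rw [eA _ hij, eB _ hjk, eC _ hki]
    exact ⟨rfl, rfl, rfl⟩

/-- Hence such a normal-form triple is equilateral trapezoid-free ([Pratt, Def. 3.2]). -/
theorem trapezoidFreeG_normalForm [DecidableEq G] [Nonempty I] [Nonempty J] [Nonempty K]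
    (hLA : Set.InjOn (fun p : I × J => x p.1 - y p.2) ↑HIJ)
    (hLB : Set.InjOn (fun q : J × K => y q.1 - z q.2) ↑HJK)
    (hLC : Set.InjOn (fun r : K × I => z r.1 - x r.2) ↑HKI)
    (hN : NoAccidental x y z HIJ HJK HKI) :
    TrapezoidFreeG (nfA x y HIJ) (nfB y z HJK) (nfC z x HKI) 0 :=
  (labelled_normalForm hLA hLB hLC hN).trapezoidFreeG

end NormalForm

end Summit.MatrixMultiplication.MatrixMultiplication.Theorems.SoloVal
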